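import Summits.HodgeConjecture.HodgeConjecture.Theorems.MotivatedLefschetzSplitLefschetzStandardBCharlesSpread
import Literature.AlgebraicGeometry.HodgeTheory.SerreKahlerWeilAnalogues
import HarnessLib

/-!
# Ring 2 hypotheses, descent face — WEIL'S HERMITIAN FORM on `Hᵏ(X(ℂ); ℂ)` and SERRE'S THÉORÈME 2 on the real
# carriers: for an operator `T` preserving Hodge types and its conjugate `Q_D`-adjoint `T'`, `Tr(T ∘ T')` is a real
# number `≥ 0`, `= 0` iff `T = 0` (the Hodge-theoretic engine of André 1996 Prop. 3.3's positivity clause)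

research route conditional on HC_CM; not a corollary; Q11.4-sentence-2 already refuted in dim ≥ 3.
Cell `pub-hodge-ring2` (Hodge ladder STAGE 3), seat `ring2-b05` (binder row b05
`Ring2.Hypotheses.MotivatedImpliesAlgebraicAV`), gen 39, part 1 of 2 (part 2: `…MotivatedPositivity`, the clause for
motivated / algebraic correspondences). `HC_CM` (`Theses.RankFourFaces.CMAbelianHodge`) does not occur in this file;
nothing here proves a case of the Hodge conjecture; the row b05 stays OPEN.

Serre, *Analogues kählériens de certaines conjectures de Weil* (1960), Thm. 2 (pp. 393–394): for the positive
hermitian form `T_V(a, b) = A(a, C b̄)` of Weil (*Variétés kählériennes*, pp. 77–78; `C` the Weil operator `i^{p-q}`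
on `H^{p,q}`) and an operator `X_r` with `T_V`-adjoint `X'_r`, «La trace de `X_r ∘ X'_r` n'est donc pas autre chose
que le carré de la norme (au sens d'Hilbert-Schmidt) de l'opérateur `X_r`» — `Tr ≥ 0`, and `= 0` only if `X_r = 0`.
The tree holds the linear algebra (`Serre1960.serre_theorem2_of_adjoint_pair`, file
`HodgeTheory/SerreKahlerWeilAnalogues`, whose docstring lists as "deliberately NOT here (geometry, not linear
algebra): the construction and positivity of `T_V` … the fact that … `X'_r` is such an adjoint"). THIS FILE SUPPLIES
THAT GEOMETRY on the real carrier `Hᵏ(X(ℂ); ℂ)` of a smooth projective `X`, from the two Hodge–Riemann relations of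
the polarisation form `Q_D = D.cform hX k` of a Kähler–rational datum `D` (Voisin I §6.3.2 Thm. 6.32 / §7.1.2; the
tree's `KaehlerRationalDatum.cform_conj_pos`, `LefschetzStandardB.cform_eq_zero_of_fst_add_fst_ne`,
`…cform_conjClass`), with `ℂ`-coefficients throughout (F-ref2-83):

* §1 `conj_I_zpow_sub`, `I_zpow_sub_mul_neg_one_pow` (the Weil constants `i^{p-q}`); `cform_flip` (`(-1)ᵏ`-symmetry);
  `cform_typeProj_conj_typeProj_eq_zero` (first Hodge–Riemann relation between type components: only `(p, q)` and
  `conj (p, q)` pair), `cform_conj_typeProj`, `cform_typeProj_conj`; `hodgeRiemannTerm_typeProj` (the terms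
  `i^{p-q} Q_D(π_{(p,q)} x, conj π_{(p,q)} x)` are reals `≥ 0`, zero only for `π_{(p,q)} x = 0`); **`cform_nondegenerate`**
  (`Q_D` is non-degenerate on `Hᵏ(X(ℂ); ℂ)`).
* §2 **`exists_innerProductSpaceCore_weil` — WEIL'S FORM `⟪x, y⟫ = Σ_{(p,q)} i^{p-q} Q_D(y, conj π_{(p,q)} x)` IS A
  POSITIVE DEFINITE HERMITIAN INNER PRODUCT** (an `InnerProductSpace.Core` on `Hᵏ(X(ℂ); ℂ)`);
  `inner_weil_adjoint_pair` (an operator `T` preserving the Hodge type pieces and any `T'` with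
  `Q_D(T' x, y) = Q_D(x, conj T conj y)` form an adjoint pair for it — Serre's hypothesis (c), DERIVED);
  **`exists_trace_comp_eq_of_typePiece_of_cform_adjoint` — SERRE'S THÉORÈME 2 ON `Hᵏ(X(ℂ); ℂ)`**: `Tr(T ∘ T')` is a
  real `≥ 0`, `= 0` iff `T = 0`; `trace_comp_cform_adjoint_conj_symm` (hermitian symmetry
  `Tr(S ∘ T') = conj Tr(T ∘ S')` of the resulting trace form); `exists_unique_cform_adjoint_conj` (the conjugate
  `Q_D`-adjoint exists uniquely).

The operator of `Q_D` is `± *_L` (André's Lefschetz involution) on each Lefschetz component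
(`Q_D(x, y) = Σ_P (-1)^{a(a-1)/2} τ(L^{n-a} ξ_P x ∪ ξ_P y)`), so `T'` is André's `* ᵗT *` for the star of `Q_D` — the case
of Prop. 2.2 Cor. 1 / §1.1 Remarque of André 1996 («cet opérateur star et `*_H` ont les mêmes propriétés de positivité
sur les cycles réels de type `(p,p)`»). No definition, no named fact, no sorry. References: Serre1960Kahler (Thm. 2,
pp. 393–394), VoisinHodgeI2002 (§6.3.2 Thm. 6.32, §7.1.2, Cor. 6.12), Andre1996Motifs (Prop. 1.2 p. 11, §1.1 Remarque
p. 11, Prop. 2.2 Cor. 1 p. 16, Prop. 3.3 pp. 21–22).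
-/

noncomputable section

-- every declaration of this problem lives in `Summit.HodgeConjecture.HodgeConjecture.…` (summit = sub-problem)
set_option linter.dupNamespace false

open CategoryTheory AlgebraicGeometry MonoidalCategory CartesianMonoidalCategory
open Literature.AlgebraicTopology.SingularHomology Literature.Geometry.Kaehler
open Literature.AlgebraicGeometry Literature.AlgebraicGeometry.Motives
  Literature.AlgebraicGeometry.HodgeTheory
open Summit.HodgeConjecture.HodgeConjecture.Theorems.LefschetzStandardB (cform_conjClass
  cform_eq_zero_of_fst_add_fst_ne)
open scoped ComplexOrder InnerProductSpace

namespace Summit.HodgeConjecture.HodgeConjecture.Theorems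

variable {n : ℕ} {X : SchemeOver ℂ}

/-! ## §1 The Weil constants `i^{p-q}` and the Hodge–Riemann relations between type components -/

/-- `conj (i^{p-q}) = i^{q-p}`. [folklore] -/
theorem conj_I_zpow_sub (p q : ℕ) :
    starRingEnd ℂ (Complex.I ^ ((p : ℤ) - q)) = Complex.I ^ ((q : ℤ) - p) := by
  rw [map_zpow₀, Complex.conj_I, ← Complex.inv_I, inv_zpow', neg_sub]

/-- `i^{q-p} · (-1)^{p+q} = i^{p-q}` (the sign `(-1)ᵏ` of the `(-1)ᵏ`-symmetric polarisation form on `Hᵏ`,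
`k = p + q`, against the Weil constants). [folklore] -/
theorem I_zpow_sub_mul_neg_one_pow (p q : ℕ) :
    Complex.I ^ ((q : ℤ) - p) * (-1 : ℂ) ^ (p + q) = Complex.I ^ ((p : ℤ) - q) := by
  have h1 : ((-1 : ℂ) ^ (p + q)) = Complex.I ^ (2 * ((p : ℤ) + q)) := by
    rw [zpow_mul, zpow_two, Complex.I_mul_I, ← zpow_natCast, Nat.cast_add]
  have h4 : Complex.I ^ (4 : ℤ) = 1 := by
    rw [show (4 : ℤ) = ((4 : ℕ) : ℤ) by rfl, zpow_natCast, Complex.I_pow_four]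
  rw [h1, ← zpow_add₀ Complex.I_ne_zero,
    show (q : ℤ) - p + 2 * ((p : ℤ) + q) = ((p : ℤ) - q) + 4 * q by ring,
    zpow_add₀ Complex.I_ne_zero, zpow_mul, h4, one_zpow, mul_one]

/-- **`(-1)ᵏ`-symmetry of the polarisation form** of a Kähler–rational datum on `Hᵏ(X(ℂ); ℂ)`:
`Q_D(y, x) = (-1)ᵏ Q_D(x, y)` (`polarizationForm_flip`). [cite: VoisinHodgeI2002, §7.1.2] -/
theorem cform_flip (hX : IsSmoothProjective n X) (D : KaehlerRationalDatum n X) {k : ℕ} (x y : complexBetti X k) :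
    D.cform hX k y x = (-1 : ℂ) ^ k * D.cform hX k x y := by
  simp only [KaehlerRationalDatum.cform]
  exact polarizationForm_flip _ _ _ x y

/-- **First Hodge–Riemann relation between type components**: for a Hodge model `A` and two DIFFERENT types
`(p, q) ≠ (p', q')` on the antidiagonal of `k`, `Q_D(π_{(p,q)} x, conj π_{(p',q')} y) = 0` (`conj π_{(p',q')} y` has
type `(q', p')`, and `p + q' ≠ k`). [cite: VoisinHodgeI2002, §7.1.2 and Cor. 6.12] -/
theorem cform_typeProj_conj_typeProj_eq_zero (hX : IsSmoothProjective n X) (D : KaehlerRationalDatum n X)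
    (A : HodgeModel n X) {k : ℕ} {pq pq' : ↥(Finset.HasAntidiagonal.antidiagonal k)} (hne : pq ≠ pq')
    (x y : complexBetti X k) :
    D.cform hX k (A.typeProj k pq x) (conjClass (ComplexPoints X) k (A.typeProj k pq' y)) = 0 := by
  have hI := hodgePQ_independent_of_hodgeModel_holds
  obtain ⟨⟨p, q⟩, hpq⟩ := pq
  obtain ⟨⟨p', q'⟩, hpq'⟩ := pq'
  have h1 : p + q = k := Finset.HasAntidiagonal.mem_antidiagonal.1 hpq
  have h2 : p' + q' = k := Finset.HasAntidiagonal.mem_antidiagonal.1 hpq'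
  -- `π_{(p,q)} x` has type `(p, q)`, `conj π_{(p',q')} y` has type `(q', p')`
  have hx : IsOfHodgeType n X k p q (A.typeProj k ⟨(p, q), hpq⟩ x) := ⟨A, A.typeProj_mem k ⟨(p, q), hpq⟩ x⟩
  have hy : IsOfHodgeType n X k p' q' (A.typeProj k ⟨(p', q'), hpq'⟩ y) :=
    ⟨A, A.typeProj_mem k ⟨(p', q'), hpq'⟩ y⟩
  have hconj : conjClass (ComplexPoints X) k (A.typeProj k ⟨(p', q'), hpq'⟩ y) ∈
      A.typePiece k ⟨(q', p'), Finset.HasAntidiagonal.mem_antidiagonal.2 (by omega)⟩ :=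
    A.mem_typePiece_of_isOfHodgeType hI hX _ (hy.conjClass hX)
  refine cform_eq_zero_of_fst_add_fst_ne hX D A hpq _ (A.mem_typePiece_of_isOfHodgeType hI hX hpq hx) hconj
    fun h ↦ hne ?_
  have hpp : p = p' := by omega
  have hqq : q = q' := by omega
  subst hpp hqq
  rfl

/-- **Only the diagonal type components pair, I**: `Q_D(x, conj π_{(p,q)} y) = Q_D(π_{(p,q)} x, conj π_{(p,q)} y)`
(expand `x = Σ π_{(p',q')} x`; the cross terms vanish by `cform_typeProj_conj_typeProj_eq_zero`).
[cite: VoisinHodgeI2002, §7.1.2] -/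
theorem cform_conj_typeProj (hX : IsSmoothProjective n X) (D : KaehlerRationalDatum n X) (A : HodgeModel n X)
    {k : ℕ} (pq : ↥(Finset.HasAntidiagonal.antidiagonal k)) (x y : complexBetti X k) :
    D.cform hX k x (conjClass (ComplexPoints X) k (A.typeProj k pq y)) =
      D.cform hX k (A.typeProj k pq x) (conjClass (ComplexPoints X) k (A.typeProj k pq y)) := by
  classical
  conv_lhs => rw [← A.sum_typeProj k x]
  rw [LinearMap.map_sum₂, Finset.sum_eq_single pq]
  · intro pq' _ hne
    exact cform_typeProj_conj_typeProj_eq_zero hX D A hne x y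
  · intro h
    exact absurd (Finset.mem_univ pq) h

/-- **Only the diagonal type components pair, II**: `Q_D(π_{(p,q)} x, conj y) = Q_D(π_{(p,q)} x, conj π_{(p,q)} y)`
(expand `y`; conjugation is additive). [cite: VoisinHodgeI2002, §7.1.2 and Cor. 6.12] -/
theorem cform_typeProj_conj (hX : IsSmoothProjective n X) (D : KaehlerRationalDatum n X) (A : HodgeModel n X)
    {k : ℕ} (pq : ↥(Finset.HasAntidiagonal.antidiagonal k)) (x y : complexBetti X k) :
    D.cform hX k (A.typeProj k pq x) (conjClass (ComplexPoints X) k y) =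
      D.cform hX k (A.typeProj k pq x) (conjClass (ComplexPoints X) k (A.typeProj k pq y)) := by
  classical
  have hconj : conjClass (ComplexPoints X) k (∑ pq', A.typeProj k pq' y) =
      ∑ pq', conjClass (ComplexPoints X) k (A.typeProj k pq' y) := by
    simpa only [conjClassEquiv_apply] using map_sum (conjClassEquiv (ComplexPoints X) k) (fun pq' ↦ A.typeProj k pq' y)
      Finset.univ
  conv_lhs => rw [← A.sum_typeProj k y, hconj]
  rw [map_sum, Finset.sum_eq_single pq]
  · intro pq' _ hne
    exact cform_typeProj_conj_typeProj_eq_zero hX D A hne.symm x y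
  · intro h
    exact absurd (Finset.mem_univ pq) h

/-- **The Hodge–Riemann terms**: for every `x ∈ Hᵏ(X(ℂ); ℂ)` and every type `(p, q)`, the number
`i^{p-q} Q_D(x, conj π_{(p,q)} x) = i^{p-q} Q_D(π_{(p,q)} x, conj π_{(p,q)} x)` is a non-negative real, and it is `0`
only if `π_{(p,q)} x = 0` (second Hodge–Riemann relation, `KaehlerRationalDatum.cform_conj_pos`).
[cite: VoisinHodgeI2002, §6.3.2 Thm. 6.32 and §7.1.2] -/
theorem hodgeRiemannTerm_typeProj (hX : IsSmoothProjective n X) (D : KaehlerRationalDatum n X) (A : HodgeModel n X)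
    {k : ℕ} (pq : ↥(Finset.HasAntidiagonal.antidiagonal k)) (x : complexBetti X k) :
    (Complex.I ^ ((pq.1.1 : ℤ) - pq.1.2) *
        D.cform hX k x (conjClass (ComplexPoints X) k (A.typeProj k pq x))).im = 0 ∧
      0 ≤ (Complex.I ^ ((pq.1.1 : ℤ) - pq.1.2) *
        D.cform hX k x (conjClass (ComplexPoints X) k (A.typeProj k pq x))).re ∧
      ((Complex.I ^ ((pq.1.1 : ℤ) - pq.1.2) *
        D.cform hX k x (conjClass (ComplexPoints X) k (A.typeProj k pq x))).re = 0 → A.typeProj k pq x = 0) := by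
  rw [cform_conj_typeProj hX D A pq x x]
  by_cases h0 : A.typeProj k pq x = 0
  · rw [h0, conjClass_zero, map_zero, mul_zero]
    exact ⟨rfl, le_rfl, fun _ ↦ rfl⟩
  · obtain ⟨r, hr, heq⟩ := D.cform_conj_pos hX A pq.2 (A.typeProj_mem k pq x) h0
    rw [heq, Complex.ofReal_im, Complex.ofReal_re]
    exact ⟨rfl, hr.le, fun h ↦ absurd h hr.ne'⟩

/-- **The polarisation form `Q_D` is non-degenerate on `Hᵏ(X(ℂ); ℂ)`**: a class `x ≠ 0` has a non-zero type
component `π_{(p,q)} x`, and `Q_D(x, conj π_{(p,q)} x) ≠ 0` by the second Hodge–Riemann relation; right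
non-degeneracy by the `(-1)ᵏ`-symmetry. [cite: VoisinHodgeI2002, §6.3.2 Thm. 6.32 and §7.1.2] -/
theorem cform_nondegenerate (hX : IsSmoothProjective n X) (D : KaehlerRationalDatum n X) (k : ℕ) :
    (D.cform hX k).Nondegenerate := by
  classical
  obtain ⟨A⟩ := nonempty_hodgeModel_holds hX
  have hleft : ∀ x : complexBetti X k, (∀ y, D.cform hX k x y = 0) → x = 0 := by
    intro x hx
    rw [← A.sum_typeProj k x]
    refine Finset.sum_eq_zero fun pq _ ↦ (hodgeRiemannTerm_typeProj hX D A pq x).2.2 ?_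
    rw [hx, mul_zero, Complex.zero_re]
  refine ⟨fun x hx ↦ hleft x hx, fun y hy ↦ hleft y fun x ↦ ?_⟩
  have h := hy x
  rw [cform_flip hX D y x] at h
  exact (mul_eq_zero.1 h).resolve_left (pow_ne_zero _ (neg_ne_zero.2 one_ne_zero))

/-! ## §2 Serre's Théorème 2 on `Hᵃ(X(ℂ); ℂ)`: Weil's hermitian form and the positivity of `Tr(T ∘ T')` -/

/-- **WEIL'S HERMITIAN FORM ON `Hᵏ(X(ℂ); ℂ)` IS A POSITIVE DEFINITE INNER PRODUCT.** For `X` smooth projective of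
dimension `n`, a Kähler–rational datum `D` (polarisation form `Q_D = D.cform hX k`) and a Hodge model `A`, the form
`⟪x, y⟫ = Σ_{(p,q)} i^{p-q} Q_D(y, conj π_{(p,q)} x)` (Weil's `T_V(y, x) = Q(C y, conj x)`, `C` the Weil operator
`i^{p-q}` on `H^{p,q}`; written conjugate-linear in the FIRST variable, Mathlib's convention) is an inner product on
`Hᵏ(X(ℂ); ℂ)` (an `InnerProductSpace.Core`): hermitian by the reality `Q_D(conj x, conj y) = conj Q_D(x, y)` and the
`(-1)ᵏ`-symmetry of `Q_D`, positive definite by the two Hodge–Riemann relations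
(`cform_typeProj_conj_typeProj_eq_zero`, `hodgeRiemannTerm_typeProj`). [cite: VoisinHodgeI2002, §6.3.2 Thm. 6.32 and §7.1.2]
[cite: Serre1960Kahler, p. 393 (the form `T_V`)] -/
theorem exists_innerProductSpaceCore_weil (hX : IsSmoothProjective n X) (D : KaehlerRationalDatum n X)
    (A : HodgeModel n X) (k : ℕ) :
    ∃ cd : InnerProductSpace.Core ℂ (complexBetti X k), ∀ x y, cd.inner x y =
      ∑ pq : ↥(Finset.HasAntidiagonal.antidiagonal k),
        Complex.I ^ ((pq.1.1 : ℤ) - pq.1.2) * D.cform hX k y (conjClass (ComplexPoints X) k (A.typeProj k pq x)) := by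
  classical
  have hpq_eq : ∀ pq : ↥(Finset.HasAntidiagonal.antidiagonal k), pq.1.1 + pq.1.2 = k := fun pq ↦
    Finset.HasAntidiagonal.mem_antidiagonal.1 pq.2
  -- Weil's hermitian form, conjugate-linear in the first variable
  let ip : complexBetti X k → complexBetti X k → ℂ := fun x y ↦
    ∑ pq : ↥(Finset.HasAntidiagonal.antidiagonal k),
      Complex.I ^ ((pq.1.1 : ℤ) - pq.1.2) * D.cform hX k y (conjClass (ComplexPoints X) k (A.typeProj k pq x))
  have hre : ∀ x, (ip x x).re = ∑ pq : ↥(Finset.HasAntidiagonal.antidiagonal k),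
      (Complex.I ^ ((pq.1.1 : ℤ) - pq.1.2) *
        D.cform hX k x (conjClass (ComplexPoints X) k (A.typeProj k pq x))).re := fun x ↦ by
    simp only [ip, Complex.re_sum]
  have hterm := fun x pq ↦ hodgeRiemannTerm_typeProj hX D A (k := k) pq x
  let cd : InnerProductSpace.Core ℂ (complexBetti X k) :=
    { inner := ip
      conj_inner_symm := fun x y ↦ by
        -- hermitian symmetry
        change starRingEnd ℂ (ip y x) = ip x y
        simp only [ip, map_sum, map_mul]
        refine Finset.sum_congr rfl fun pq _ ↦ ?_
        rw [conj_I_zpow_sub, ← cform_conjClass hX D, conjClass_conjClass, cform_flip hX D,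
          cform_typeProj_conj hX D A pq, cform_conj_typeProj hX D A pq y x, ← mul_assoc,
          show ((-1 : ℂ) ^ k) = (-1) ^ (pq.1.1 + pq.1.2) by rw [hpq_eq pq], I_zpow_sub_mul_neg_one_pow]
      re_inner_nonneg := fun x ↦ by
        change 0 ≤ (ip x x).re
        rw [hre x]
        exact Finset.sum_nonneg fun pq _ ↦ (hterm x pq).2.1
      add_left := fun x y z ↦ by
        change ip (x + y) z = ip x z + ip y z
        simp only [ip, map_add, conjClass_add, mul_add, Finset.sum_add_distrib]
      smul_left := fun x y r ↦ by
        change ip (r • x) y = starRingEnd ℂ r * ip x y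
        simp only [ip, map_smul, conjClass_smul, smul_eq_mul, Finset.mul_sum]
        exact Finset.sum_congr rfl fun pq _ ↦ by ring
      definite := fun x hx ↦ by
        -- definiteness: every Hodge–Riemann term vanishes, so every type component does
        change ip x x = 0 at hx
        have hre0 : ∑ pq : ↥(Finset.HasAntidiagonal.antidiagonal k),
            (Complex.I ^ ((pq.1.1 : ℤ) - pq.1.2) *
              D.cform hX k x (conjClass (ComplexPoints X) k (A.typeProj k pq x))).re = 0 := by
          rw [← hre x, hx, Complex.zero_re]
        have hall := (Finset.sum_eq_zero_iff_of_nonneg fun pq _ ↦ (hterm x pq).2.1).1 hre0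
        rw [← A.sum_typeProj k x]
        exact Finset.sum_eq_zero fun pq _ ↦ (hterm x pq).2.2 (hall pq (Finset.mem_univ _)) }
  exact ⟨cd, fun x y ↦ rfl⟩

/-- **The adjunction for Weil's form**: if `T` preserves the Hodge type pieces of `A` and
`Q_D(T' x, y) = Q_D(x, conj (T (conj y)))` for all `x, y`, then `⟪T a, b⟫ = ⟪a, T' b⟫` for Weil's form
(`T` commutes with the type projectors). This is Serre's hypothesis (c) «les opérateurs `X_r` et `X'_r` sont adjoints
l'un de l'autre par rapport aux formes `T_V`», here DERIVED for type-preserving operators.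
[cite: Serre1960Kahler, Thm 2, pp. 393–394] [cite: Andre1996Motifs, Prop. 1.2 (p. 11)] -/
theorem inner_weil_adjoint_pair (hX : IsSmoothProjective n X) (D : KaehlerRationalDatum n X) (A : HodgeModel n X)
    {k : ℕ} {cd : InnerProductSpace.Core ℂ (complexBetti X k)}
    (hcd : ∀ x y, cd.inner x y = ∑ pq : ↥(Finset.HasAntidiagonal.antidiagonal k),
      Complex.I ^ ((pq.1.1 : ℤ) - pq.1.2) * D.cform hX k y (conjClass (ComplexPoints X) k (A.typeProj k pq x)))
    {T T' : complexBetti X k →ₗ[ℂ] complexBetti X k}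
    (hT : ∀ pq, ∀ x ∈ A.typePiece k pq, T x ∈ A.typePiece k pq)
    (hT' : ∀ x y, D.cform hX k (T' x) y =
      D.cform hX k x (conjClass (ComplexPoints X) k (T (conjClass (ComplexPoints X) k y))))
    (a b : complexBetti X k) : cd.inner (T a) b = cd.inner a (T' b) := by
  classical
  -- `T` commutes with the type projectors
  have hcomm : ∀ (pq : ↥(Finset.HasAntidiagonal.antidiagonal k)) (x : complexBetti X k),
      A.typeProj k pq (T x) = T (A.typeProj k pq x) := fun pq x ↦
    A.typeProj_eq_of_sum_eq (y := fun pq ↦ T (A.typeProj k pq x))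
      (fun pq ↦ hT pq _ (A.typeProj_mem k pq x)) (by rw [← map_sum, A.sum_typeProj]) pq
  rw [hcd, hcd]
  refine Finset.sum_congr rfl fun pq _ ↦ ?_
  rw [hcomm, hT', conjClass_conjClass]

/-- **SERRE'S THÉORÈME 2 ON THE REAL CARRIER `Hᵏ(X(ℂ); ℂ)`.** Let `X` be smooth projective of dimension `n`, `D` a
Kähler–rational datum (polarisation form `Q_D = D.cform hX k`), `A` a Hodge model. Let `T` be a `ℂ`-linear
endomorphism of `Hᵏ(X(ℂ); ℂ)` preserving every Hodge type piece `A.typePiece k (p, q)`, and `T'` an endomorphism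
with `Q_D(T' x, y) = Q_D(x, conj (T (conj y)))` for all `x, y` (the `Q_D`-adjoint of the complex-conjugate operator
`conj ∘ T ∘ conj`; for a REAL `T` this is the `Q_D`-adjoint of `T`, André's `T' = * ᵗT *`). Then `Tr(T ∘ T')` is a
non-negative real number, and it vanishes iff `T = 0`: `(T, T')` is an adjoint pair for Weil's positive definite
hermitian form (`exists_innerProductSpaceCore_weil`, `inner_weil_adjoint_pair`), so Serre's Hilbert–Schmidt
argument `Tr(T ∘ T') = Σᵢ ‖T' eᵢ‖²` applies (`Serre1960.serre_theorem2_of_adjoint_pair`).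
[cite: Serre1960Kahler, Thm 2, pp. 393–394] [cite: VoisinHodgeI2002, §6.3.2 Thm. 6.32 and §7.1.2]
[cite: Andre1996Motifs, Prop. 3.3 (pp. 21–22)] -/
theorem exists_trace_comp_eq_of_typePiece_of_cform_adjoint (hX : IsSmoothProjective n X)
    (D : KaehlerRationalDatum n X) (A : HodgeModel n X) {k : ℕ}
    {T T' : complexBetti X k →ₗ[ℂ] complexBetti X k}
    (hT : ∀ pq, ∀ x ∈ A.typePiece k pq, T x ∈ A.typePiece k pq)
    (hT' : ∀ x y, D.cform hX k (T' x) y =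
      D.cform hX k x (conjClass (ComplexPoints X) k (T (conjClass (ComplexPoints X) k y)))) :
    ∃ r : ℝ, 0 ≤ r ∧ LinearMap.trace ℂ _ (T ∘ₗ T') = r ∧ (r = 0 ↔ T = 0) := by
  obtain ⟨cd, hcd⟩ := exists_innerProductSpaceCore_weil hX D A k
  letI : NormedAddCommGroup (complexBetti X k) := @InnerProductSpace.Core.toNormedAddCommGroup ℂ _ _ _ _ cd
  letI : InnerProductSpace ℂ (complexBetti X k) := InnerProductSpace.ofCore cd.toCore
  haveI : FiniteDimensional ℂ (complexBetti X k) := finite_complexBetti hX k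
  -- `(T, T')` is an adjoint pair for Weil's form
  have hadj : ∀ a b : complexBetti X k, ⟪T a, b⟫_ℂ = ⟪a, T' b⟫_ℂ := fun a b ↦
    inner_weil_adjoint_pair hX D A hcd hT hT' a b
  obtain ⟨hnn, hzero⟩ := Serre1960.serre_theorem2_of_adjoint_pair T T' hadj
  obtain ⟨hre_nn, him0⟩ := RCLike.nonneg_iff.1 hnn
  change 0 ≤ (LinearMap.trace ℂ _ (T ∘ₗ T')).re at hre_nn
  change (LinearMap.trace ℂ _ (T ∘ₗ T')).im = 0 at him0
  refine ⟨(LinearMap.trace ℂ _ (T ∘ₗ T')).re, hre_nn, Complex.ext (by simp) (by simp [him0]), fun h ↦ hzero ?_,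
    fun h ↦ ?_⟩
  · exact Complex.ext (by simpa using h) (by simp [him0])
  · simp [h]

/-- **HERMITIAN SYMMETRY OF ANDRÉ'S TRACE FORM** («la forme bilinéaire symétrique … `(u, v) ↦ Tr(u ∘ v')`», here its
sesquilinear version on `ℂ`-linear operators): for two type-preserving endomorphisms `S`, `T` of `Hᵏ(X(ℂ); ℂ)` with
conjugate `Q_D`-adjoints `S'`, `T'`, `Tr(S ∘ T') = conj Tr(T ∘ S')` (both are `Σᵢ ⟪S† eᵢ, T† eᵢ⟫` up to conjugation, for
an orthonormal basis of Weil's form). For REAL operators with real traces this is the symmetry of André's bilinear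
form. [cite: Andre1996Motifs, Prop. 3.3 (pp. 21–22)] [cite: Serre1960Kahler, Thm 2, pp. 393–394] -/
theorem trace_comp_cform_adjoint_conj_symm (hX : IsSmoothProjective n X) (D : KaehlerRationalDatum n X)
    (A : HodgeModel n X) {k : ℕ} {S S' T T' : complexBetti X k →ₗ[ℂ] complexBetti X k}
    (hS : ∀ pq, ∀ x ∈ A.typePiece k pq, S x ∈ A.typePiece k pq)
    (hS' : ∀ x y, D.cform hX k (S' x) y =
      D.cform hX k x (conjClass (ComplexPoints X) k (S (conjClass (ComplexPoints X) k y))))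
    (hT : ∀ pq, ∀ x ∈ A.typePiece k pq, T x ∈ A.typePiece k pq)
    (hT' : ∀ x y, D.cform hX k (T' x) y =
      D.cform hX k x (conjClass (ComplexPoints X) k (T (conjClass (ComplexPoints X) k y)))) :
    LinearMap.trace ℂ _ (S ∘ₗ T') = starRingEnd ℂ (LinearMap.trace ℂ _ (T ∘ₗ S')) := by
  obtain ⟨cd, hcd⟩ := exists_innerProductSpaceCore_weil hX D A k
  letI : NormedAddCommGroup (complexBetti X k) := @InnerProductSpace.Core.toNormedAddCommGroup ℂ _ _ _ _ cd
  letI : InnerProductSpace ℂ (complexBetti X k) := InnerProductSpace.ofCore cd.toCore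
  haveI : FiniteDimensional ℂ (complexBetti X k) := finite_complexBetti hX k
  -- `S' = S†`, `T' = T†` for Weil's form
  have hadjS : ∀ a b : complexBetti X k, ⟪S a, b⟫_ℂ = ⟪a, S' b⟫_ℂ := fun a b ↦
    inner_weil_adjoint_pair hX D A hcd hS hS' a b
  have hadjT : ∀ a b : complexBetti X k, ⟪T a, b⟫_ℂ = ⟪a, T' b⟫_ℂ := fun a b ↦
    inner_weil_adjoint_pair hX D A hcd hT hT' a b
  have hS'eq : S' = LinearMap.adjoint S := by
    refine (LinearMap.eq_adjoint_iff S' S).mpr fun b a ↦ ?_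
    rw [← inner_conj_symm, ← hadjS, inner_conj_symm]
  have hT'eq : T' = LinearMap.adjoint T := by
    refine (LinearMap.eq_adjoint_iff T' T).mpr fun b a ↦ ?_
    rw [← inner_conj_symm, ← hadjT, inner_conj_symm]
  subst hS'eq hT'eq
  set b := stdOrthonormalBasis ℂ (complexBetti X k)
  rw [LinearMap.trace_eq_sum_inner _ b, LinearMap.trace_eq_sum_inner _ b, map_sum]
  refine Finset.sum_congr rfl fun i _ ↦ ?_
  rw [LinearMap.comp_apply, LinearMap.comp_apply, ← LinearMap.adjoint_inner_left S,
    ← LinearMap.adjoint_inner_left T, inner_conj_symm]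

/-- **Existence and uniqueness of the conjugate adjoint**: for every endomorphism `T` of `Hᵏ(X(ℂ); ℂ)` there is a
unique `T'` with `Q_D(T' x, y) = Q_D(x, conj (T (conj y)))` (the `Q_D`-adjoint of the `ℂ`-linear operator
`conj ∘ T ∘ conj`; `Q_D` is non-degenerate, `cform_nondegenerate`). [cite: VoisinHodgeI2002, §7.1.2]
[cite: Andre1996Motifs, Prop. 1.2 (p. 11)] -/
theorem exists_unique_cform_adjoint_conj (hX : IsSmoothProjective n X) (D : KaehlerRationalDatum n X) {k : ℕ}
    (T : complexBetti X k →ₗ[ℂ] complexBetti X k) :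
    ∃! T' : complexBetti X k →ₗ[ℂ] complexBetti X k, ∀ x y, D.cform hX k (T' x) y =
      D.cform hX k x (conjClass (ComplexPoints X) k (T (conjClass (ComplexPoints X) k y))) := by
  haveI : FiniteDimensional ℂ (complexBetti X k) := finite_complexBetti hX k
  -- the `ℂ`-linear operator `conj ∘ T ∘ conj`
  let Tc : complexBetti X k →ₗ[ℂ] complexBetti X k :=
    { toFun := fun y ↦ conjClass (ComplexPoints X) k (T (conjClass (ComplexPoints X) k y))
      map_add' := fun y z ↦ by rw [conjClass_add, map_add, conjClass_add]
      map_smul' := fun c y ↦ by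
        rw [conjClass_smul, map_smul, conjClass_smul, starRingEnd_self_apply, RingHom.id_apply] }
  have hQ := cform_nondegenerate hX D k
  refine ⟨(D.cform hX k).leftAdjointOfNondegenerate hQ Tc,
    fun x y ↦ (D.cform hX k).isAdjointPairLeftAdjointOfNondegenerate hQ Tc x y, fun T' hT' ↦ ?_⟩
  exact (D.cform hX k).isAdjointPair_unique_of_nondegenerate hQ Tc _ _ (fun x y ↦ hT' x y)
    ((D.cform hX k).isAdjointPairLeftAdjointOfNondegenerate hQ Tc)

end Summit.HodgeConjecture.HodgeConjecture.Theorems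

end
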